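import Summits.QuantumFields.YangMills.Theorems.ColdStartUniversalityShenZhuZhuHaarCeilingSUN
import HarnessLib

/-!
# The Haar ceiling in Shen–Zhu–Zhu's own setting: for EVERY infinite-volume limit point of `SU(N)` lattice Yang–Mills, at EVERY coupling, no
# Poincaré inequality in the printed gradient form `K·Var_μ(F) ≤ Σ_e μ(|∇_e F|²)` can have `K > (N² − 1)/N`

Seat `ym-line-csu-p1` (g40), route `ColdStartUniversality` of `Summits/QuantumFields/YangMills`, helper file G36 (`--supports stmt-QuantumFields-24809`).
Companion of G33 (torus, Γ-currency): the same Elitzur mechanism for the infinite-volume limit points `μ ∈ infiniteVolumeLimitPoints ρ β'` of SZZ's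
Theorem 1.4 and in the Literature's `linkGradSq` currency of (1.10)/(4.13).

* §1 ★★ `integral_link_eq_haar_limit_sun` — single-link marginals of every infinite-volume limit point are Haar (continuous test functions), every
  `N ≥ 1`, `d`, `β'` (limit of G33's torus statement along the defining sequence of tori).
* §2 `linkGradSq_linkEntry_eq` — for the one-link cylinders `F = Re tr(U_{e₀} M)`: `|∇_{e₀} F|²(U) = Γ₁(Re tr(·M))(U_{e₀})` (left/right invariance at
  unitary links); `rayleigh_linkEntries_limit_sun` — `Σ_F ∫|∇F|² dμ = (N − 1/N)·N`, `Σ_F Var_μ(F) = N` over the `2N²` entry observables.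
* §3 ★★★ `limitPoincareConst_le_haarCeiling_sun` — THE CEILING for limit points: if `K·Var_μ(F) ≤ Σ_{e∈Λ} ∫ linkGradSq Λ f e dμ` for all smooth cylinders
  then `K ≤ N − 1/N` (`N ≥ 2`, any `β'`, any `d ≥ 1`); with G31: at `|β| < 1/(8d)` the optimal gradient-form Poincaré constant of every limit point lies in
  `[N/2 − 4dN|β|, N − 1/N]` (`limitPoincareConst_window_sun`).

THEOREMS ONLY, no definition, no sorry.  HONEST FRAMING: fixed-lattice structural facts (strong AND weak coupling: the ceiling holds at every `β'`, but
it is an UPPER bound on spectral gaps in lattice units only); no bearing on `K`-uniformity in physical units along the route's scaling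
(`UniformColdStartMixing`, 24809, ASIDE, not restated); no crux, rung or summit statement is proved; the Yang–Mills mass gap is NOT proved.
References: S. Elitzur, Phys. Rev. D 12 (1975) 3978 [Elitzur1975]; H. Shen, R. Zhu, X. Zhu, CMP 400 (2023), Thm 1.4 (1.10) [ShenZhuZhu2022].
-/

set_option autoImplicit false

noncomputable section

namespace Summit.QuantumFields.YangMills.Theorems.ColdStartUniversality

open MeasureTheory ProbabilityTheory Finset Filter Set Function
open scoped BigOperators NNReal ENNReal Topology Matrix Matrix.Norms.Frobenius ContDiff
open Literature.MathematicalPhysics.QuantumFieldTheory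
open Literature.MathematicalPhysics.QuantumLattice (fundamentalRep continuous_fundamentalRep fundamentalRep_apply torusEdge torusLift LGConfig
  toTorusObservable infiniteVolumeLimitPoints IsCylinder)
open Literature.MathematicalPhysics.QuantumFieldTheory.SUNBakryEmery (SUN FrameIdx frame contDiff_reTrMul reTrMul haarSU)

variable {d N : ℕ}

/-! ## §1. Single-link marginals of infinite-volume limit points are Haar -/

/-- ★★ **Single-link marginals of every infinite-volume limit point are Haar** (Elitzur, in infinite volume): for `μ ∈ infiniteVolumeLimitPoints ρ β'`
(`ρ` the fundamental representation of `SU(N)`, `N ≥ 1`, any `d`, any `β'`), every link `e` of `ℤ^d` and every continuous `g : SU(N) → ℝ`,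
`∫ g(U_e) dμ = ∫ g dσ_{SU(N)}` — along the defining sequence of tori the torus expectations are constantly the Haar integral (G33).
[cite: Elitzur1975, (local gauge invariance)] -/
theorem integral_link_eq_haar_limit_sun {β' : ℝ} {μ : Measure (LGConfig d (SUN N))}
    (hμ : μ ∈ infiniteVolumeLimitPoints (d := d) (fundamentalRep (Fin N)) β') (e : Literature.MathematicalPhysics.QuantumLattice.ZdEdge d)
    {g : SUN N → ℝ} (hg : Continuous g) :
    ∫ U, g (U e) ∂μ = ∫ x, g x ∂(haarProbability (SUN N)) := by
  haveI : SecondCountableTopology (Matrix (Fin N) (Fin N) ℂ) := inferInstanceAs (SecondCountableTopology (Fin N → Fin N → ℂ))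
  haveI : SecondCountableTopology (SUN N) := Topology.IsEmbedding.subtypeVal.secondCountableTopology
  obtain ⟨Ls, hLs, hprob, hlim⟩ := hμ
  set F : LGConfig d (SUN N) → ℝ := fun U => g (U e) with hF
  have hFcyl : IsCylinder F {e} := fun U V hUV => by
    show g (U e) = g (V e); rw [hUV e (Finset.mem_singleton_self e)]
  have hFc : Continuous F := hg.comp (continuous_apply e)
  obtain ⟨B, hB⟩ : ∃ B, ∀ x : SUN N, |g x| ≤ B := by
    obtain ⟨B, hB⟩ := (isCompact_univ (X := SUN N)).exists_bound_of_continuousOn hg.continuousOn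
    exact ⟨B, fun x => by simpa [Real.norm_eq_abs] using hB x (Set.mem_univ _)⟩
  have ht := hlim F {e} hFcyl hFc ⟨B, fun U => hB (U e)⟩
  have hconst : ∀ᶠ k : ℕ in atTop, wilsonExpectation (L := Ls k + 1) (fundamentalRep (Fin N)) β' (toTorusObservable (Ls k + 1) F) =
      ∫ x, g x ∂(haarProbability (SUN N)) := by
    have h2 : ∀ᶠ k : ℕ in atTop, 1 ≤ Ls k := (hLs.tendsto_atTop).eventually (eventually_ge_atTop 1)
    refine h2.mono fun k hk => ?_
    unfold wilsonExpectation
    exact integral_link_eq_haar_general (d := d) (L := Ls k + 1) (fundamentalRep (Fin N)) (continuous_fundamentalRep (n := Fin N)) β'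
      (by omega) (torusEdge (Ls k + 1) e) g hg.measurable hB
  exact tendsto_nhds_unique ht (tendsto_const_nhds.congr' (hconst.mono fun k hk => hk.symm))

/-! ## §2. The one-link entry cylinders: gradients and Rayleigh sums under a limit point -/

/-- **The squared link gradient of a one-link cylinder `F(U) = Re tr(U_{e₀} M)` at `SU(N)` configurations is the one-link carré du champ**
`Γ₁(Re tr(·M))(U_{e₀})` (right-invariant `linkGradSq` versus left-invariant `Γ₁`: equal by bi-invariance). [cite: ShenZhuZhu2022, §2 (2.3)–(2.4)] -/
theorem linkGradSq_linkEntry_eq (hN : N ≠ 0) (e₀ : Literature.MathematicalPhysics.QuantumLattice.ZdEdge d) (M : Matrix (Fin N) (Fin N) ℂ)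
    (U : LGConfig d (SUN N)) :
    linkGradSq ({e₀} : Finset _) (fun m : (↥({e₀} : Finset (Literature.MathematicalPhysics.QuantumLattice.ZdEdge d)) → Matrix (Fin N) (Fin N) ℂ) =>
        (m ⟨e₀, Finset.mem_singleton_self e₀⟩ * M).trace.re) ⟨e₀, Finset.mem_singleton_self e₀⟩
      (fun e' => ((U e'.1 : SUN N) : Matrix (Fin N) (Fin N) ℂ)) =
      SUNBakryEmery.Gam (fun Q : Matrix (Fin N) (Fin N) ℂ => (Q * M).trace.re) (fun Q => (Q * M).trace.re) ((U e₀ : SUN N) : Matrix (Fin N) (Fin N) ℂ) := by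
  classical
  set e : ↥({e₀} : Finset (Literature.MathematicalPhysics.QuantumLattice.ZdEdge d)) := ⟨e₀, Finset.mem_singleton_self e₀⟩ with he
  set P : (↥({e₀} : Finset (Literature.MathematicalPhysics.QuantumLattice.ZdEdge d)) → Matrix (Fin N) (Fin N) ℂ) →L[ℝ] Matrix (Fin N) (Fin N) ℂ :=
    ContinuousLinearMap.proj (R := ℝ) (φ := fun _ : ↥({e₀} : Finset _) => Matrix (Fin N) (Fin N) ℂ) e with hP
  have hf : (fun m : (↥({e₀} : Finset (Literature.MathematicalPhysics.QuantumLattice.ZdEdge d)) → Matrix (Fin N) (Fin N) ℂ) => (m e * M).trace.re) =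
      fun m => reTrMul M (P m) := rfl
  have hfd : Differentiable ℝ (fun m : (↥({e₀} : Finset (Literature.MathematicalPhysics.QuantumLattice.ZdEdge d)) → Matrix (Fin N) (Fin N) ℂ) =>
      (m e * M).trace.re) := by rw [hf]; exact (reTrMul M).differentiable.comp P.differentiable
  set m₀ : ↥({e₀} : Finset (Literature.MathematicalPhysics.QuantumLattice.ZdEdge d)) → Matrix (Fin N) (Fin N) ℂ :=
    fun e' => ((U e'.1 : SUN N) : Matrix (Fin N) (Fin N) ℂ) with hm₀
  rw [linkGradSq_eq_sum_sq_fderiv _ hfd e m₀]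
  have hder : ∀ v, fderiv ℝ (fun m : (↥({e₀} : Finset (Literature.MathematicalPhysics.QuantumLattice.ZdEdge d)) → Matrix (Fin N) (Fin N) ℂ) =>
      (m e * M).trace.re) m₀ v = (v e * M).trace.re := by
    intro v
    rw [hf, show (fun m : (↥({e₀} : Finset (Literature.MathematicalPhysics.QuantumLattice.ZdEdge d)) → Matrix (Fin N) (Fin N) ℂ) =>
        reTrMul M (P m)) = ⇑((reTrMul M).comp P) from rfl, ((reTrMul M).comp P).fderiv]
    rfl
  simp only [hder, Pi.single_eq_same]
  -- right-invariant `Σ_α (Re tr(Y_α Q M))²` versus left-invariant `Γ₁ = Σ_α (Re tr(Q Y_α M))²`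
  have hUe : m₀ e ∈ Matrix.unitaryGroup (Fin N) ℂ := (U e₀).2.1
  have h := SUNBakryEmery.sum_sq_apply_frame_mul_eq_sum_sq_apply_mul_frame hN ((reTrMul M).toLinearMap)
    (Matrix.mem_unitaryGroup_iff.1 hUe) (Matrix.mem_unitaryGroup_iff'.1 hUe)
  simp only [ContinuousLinearMap.coe_coe, SUNBakryEmery.reTrMul_apply] at h
  rw [h]
  simp only [SUNBakryEmery.Gam, SUNBakryEmery.matD_reTrMul, sq]
  rfl

/-- **Rayleigh sums under every limit point**: for `N ≥ 2`, any `d`, `β'`, `μ ∈ infiniteVolumeLimitPoints`, and link `e₀`: over the `2N²` entry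
observables `F = Re tr(U_{e₀}M)`, `M ∈ {E_{ba}, −iE_{ba}}`: `Σ_F ∫ |∇_{e₀}F|² dμ = (N − 1/N)·N` and `Σ_F Var_μ(F) = N`. [cite: Elitzur1975, (local gauge invariance)] -/
theorem rayleigh_linkEntries_limit_sun (hN : 2 ≤ N) {β' : ℝ} {μ : Measure (LGConfig d (SUN N))}
    (hμ : μ ∈ infiniteVolumeLimitPoints (d := d) (fundamentalRep (Fin N)) β') (e₀ : Literature.MathematicalPhysics.QuantumLattice.ZdEdge d) :
    (∑ a : Fin N, ∑ b : Fin N, ∑ c ∈ ({(1 : ℂ), -Complex.I} : Finset ℂ),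
        ∫ U, linkGradSq ({e₀} : Finset _) (fun m : (↥({e₀} : Finset (Literature.MathematicalPhysics.QuantumLattice.ZdEdge d)) → Matrix (Fin N) (Fin N) ℂ) =>
            (m ⟨e₀, Finset.mem_singleton_self e₀⟩ * Matrix.single b a c).trace.re) ⟨e₀, Finset.mem_singleton_self e₀⟩
          (fun e' => ((U e'.1 : SUN N) : Matrix (Fin N) (Fin N) ℂ)) ∂μ = ((N : ℝ) - 1 / N) * N) ∧
    (∑ a : Fin N, ∑ b : Fin N, ∑ c ∈ ({(1 : ℂ), -Complex.I} : Finset ℂ),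
        Var[fun U : LGConfig d (SUN N) => (((U e₀ : SUN N) : Matrix (Fin N) (Fin N) ℂ) * Matrix.single b a c).trace.re; μ] = N) := by
  have hN0 : N ≠ 0 := by omega
  obtain ⟨Ls, hLs, hprob, hlim⟩ := id hμ
  haveI := hprob
  haveI : SecondCountableTopology (Matrix (Fin N) (Fin N) ℂ) := inferInstanceAs (SecondCountableTopology (Fin N → Fin N → ℂ))
  haveI : SecondCountableTopology (SUN N) := Topology.IsEmbedding.subtypeVal.secondCountableTopology
  have hne : (1 : ℂ) ∉ ({-Complex.I} : Finset ℂ) := by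
    rw [Finset.mem_singleton]; intro h; have := congrArg Complex.re h; simp at this
  have key : ∀ M : Matrix (Fin N) (Fin N) ℂ,
      (∫ U, linkGradSq ({e₀} : Finset _) (fun m : (↥({e₀} : Finset (Literature.MathematicalPhysics.QuantumLattice.ZdEdge d)) → Matrix (Fin N) (Fin N) ℂ) =>
            (m ⟨e₀, Finset.mem_singleton_self e₀⟩ * M).trace.re) ⟨e₀, Finset.mem_singleton_self e₀⟩
          (fun e' => ((U e'.1 : SUN N) : Matrix (Fin N) (Fin N) ℂ)) ∂μ =
          ((N : ℝ) - 1 / N) * ∫ g : SUN N, ((g : Matrix (Fin N) (Fin N) ℂ) * M).trace.re ^ 2 ∂(haarSU N)) ∧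
      Var[fun U : LGConfig d (SUN N) => (((U e₀ : SUN N) : Matrix (Fin N) (Fin N) ℂ) * M).trace.re; μ] =
          ∫ g : SUN N, ((g : Matrix (Fin N) (Fin N) ℂ) * M).trace.re ^ 2 ∂(haarSU N) := by
    intro M
    set fM : Matrix (Fin N) (Fin N) ℂ → ℝ := fun Q => (Q * M).trace.re with hfM
    have hfc : ContDiff ℝ ∞ fM := contDiff_reTrMul M
    have hgc : Continuous fun g : SUN N => fM g := hfc.continuous.comp continuous_subtype_val
    have hGc : Continuous fun g : SUN N => SUNBakryEmery.Gam fM fM g :=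
      (SUNBakryEmery.contDiff_Gam hfc hfc).continuous.comp continuous_subtype_val
    obtain ⟨B, hB⟩ : ∃ B, ∀ g : SUN N, |fM g| ≤ B := by
      obtain ⟨B, hB⟩ := (isCompact_univ (X := SUN N)).exists_bound_of_continuousOn hgc.continuousOn
      exact ⟨B, fun g => by simpa [Real.norm_eq_abs] using hB g (Set.mem_univ _)⟩
    refine ⟨?_, ?_⟩
    · calc _ = ∫ U, SUNBakryEmery.Gam fM fM ((U e₀ : SUN N) : Matrix (Fin N) (Fin N) ℂ) ∂μ :=
            integral_congr_ae (ae_of_all _ fun U => linkGradSq_linkEntry_eq hN0 e₀ M U)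
        _ = ∫ g : SUN N, SUNBakryEmery.Gam fM fM g ∂(haarProbability (SUN N)) :=
            integral_link_eq_haar_limit_sun hμ e₀ (g := fun g : SUN N => SUNBakryEmery.Gam fM fM g) hGc
        _ = ((N : ℝ) - 1 / N) * ∫ g : SUN N, ((g : Matrix (Fin N) (Fin N) ℂ) * M).trace.re ^ 2 ∂(haarSU N) :=
            integral_Gam_reTrMul_sun hN0 M
    · have hmem : MemLp (fun U : LGConfig d (SUN N) => fM ((U e₀ : SUN N) : Matrix (Fin N) (Fin N) ℂ)) 2 μ :=
        MemLp.of_bound ((hgc.comp (continuous_apply e₀)).aestronglyMeasurable) B (ae_of_all _ fun U => by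
          rw [Real.norm_eq_abs]; exact hB _)
      have h1 := integral_link_eq_haar_limit_sun hμ e₀ (g := fun g : SUN N => fM g) hgc
      have h2 := integral_link_eq_haar_limit_sun hμ e₀ (g := fun g : SUN N => fM g ^ 2) (hgc.pow 2)
      rw [integral_reTrMul_eq_zero_sun hN M] at h1
      rw [variance_eq_sub hmem]
      show (∫ U, fM ((U e₀ : SUN N) : Matrix (Fin N) (Fin N) ℂ) ^ 2 ∂μ) - (∫ U, fM ((U e₀ : SUN N) : Matrix (Fin N) (Fin N) ℂ) ∂μ) ^ 2 = _
      rw [h2, h1, zero_pow two_ne_zero, sub_zero]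
  have k1 := fun M : Matrix (Fin N) (Fin N) ℂ => (key M).1
  have k2 := fun M : Matrix (Fin N) (Fin N) ℂ => (key M).2
  refine ⟨?_, ?_⟩
  · rw [Finset.sum_congr rfl fun a _ => Finset.sum_congr rfl fun b _ => Finset.sum_congr rfl fun c _ => k1 (Matrix.single b a c)]
    simp_rw [Finset.sum_insert hne, Finset.sum_singleton, ← mul_add, ← Finset.mul_sum]
    rw [sum_integral_sq_entries_sun hN0]
  · rw [Finset.sum_congr rfl fun a _ => Finset.sum_congr rfl fun b _ => Finset.sum_congr rfl fun c _ => k2 (Matrix.single b a c)]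
    simp_rw [Finset.sum_insert hne, Finset.sum_singleton]
    exact sum_integral_sq_entries_sun hN0

/-! ## §3. The ceiling for infinite-volume limit points -/

/-- ★★★ **THE HAAR CEILING FOR INFINITE-VOLUME LIMIT POINTS** (SZZ's setting of Theorem 1.4, every `SU(N)` with `N ≥ 2`, every `d`, EVERY coupling):
if an infinite-volume limit point `μ` of the torus Wilson states satisfies a Poincaré inequality in the printed gradient form,
`K·Var_μ(F) ≤ Σ_{e∈Λ} ∫ |∇_e F|² dμ` for every finite `Λ` and every smooth cylinder `F = f((U_e)_{e∈Λ})`, then `K ≤ N − 1/N = (N² − 1)/N` — the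
inverse spectral gap of SZZ's (1.10) can never be smaller than `N/(N² − 1)`, whatever `β`.  HONEST FRAMING: an upper bound on lattice-unit gaps;
the Yang–Mills mass gap is NOT proved. [cite: Elitzur1975, (local gauge invariance)] -/
theorem limitPoincareConst_le_haarCeiling_sun (hN : 2 ≤ N) {β' : ℝ} {μ : Measure (LGConfig d (SUN N))}
    (hμ : μ ∈ infiniteVolumeLimitPoints (d := d) (fundamentalRep (Fin N)) β') (e₀ : Literature.MathematicalPhysics.QuantumLattice.ZdEdge d) {K : ℝ}
    (hK : ∀ (Λ : Finset (Literature.MathematicalPhysics.QuantumLattice.ZdEdge d)) (f : (↥Λ → Matrix (Fin N) (Fin N) ℂ) → ℝ), ContDiff ℝ ∞ f →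
      K * Var[matrixCylinder Λ f; μ] ≤ ∑ e : ↥Λ, ∫ U, linkGradSq Λ f e (fun e' : ↥Λ => ((U e'.1 : SUN N) : Matrix (Fin N) (Fin N) ℂ)) ∂μ) :
    K ≤ (N : ℝ) - 1 / N := by
  classical
  obtain ⟨hG, hV⟩ := rayleigh_linkEntries_limit_sun hN hμ e₀
  have hNpos : (0 : ℝ) < N := by exact_mod_cast (show 0 < N by omega)
  set e : ↥({e₀} : Finset (Literature.MathematicalPhysics.QuantumLattice.ZdEdge d)) := ⟨e₀, Finset.mem_singleton_self e₀⟩ with he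
  -- the hypothesis on each one-link entry cylinder
  have hone : ∀ M : Matrix (Fin N) (Fin N) ℂ,
      K * Var[fun U : LGConfig d (SUN N) => (((U e₀ : SUN N) : Matrix (Fin N) (Fin N) ℂ) * M).trace.re; μ] ≤
        ∫ U, linkGradSq ({e₀} : Finset _) (fun m : (↥({e₀} : Finset (Literature.MathematicalPhysics.QuantumLattice.ZdEdge d)) → Matrix (Fin N) (Fin N) ℂ) =>
            (m e * M).trace.re) e (fun e' => ((U e'.1 : SUN N) : Matrix (Fin N) (Fin N) ℂ)) ∂μ := by
    intro M
    have hf : ContDiff ℝ ∞ (fun m : (↥({e₀} : Finset (Literature.MathematicalPhysics.QuantumLattice.ZdEdge d)) → Matrix (Fin N) (Fin N) ℂ) =>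
        (m e * M).trace.re) := (contDiff_reTrMul M).comp (contDiff_apply ℝ (Matrix (Fin N) (Fin N) ℂ) e)
    have h := hK {e₀} _ hf
    rw [Fintype.sum_unique] at h
    have hcyl : (matrixCylinder ({e₀} : Finset _) (fun m : (↥({e₀} : Finset (Literature.MathematicalPhysics.QuantumLattice.ZdEdge d)) →
        Matrix (Fin N) (Fin N) ℂ) => (m e * M).trace.re) : LGConfig d (SUN N) → ℝ) =
        fun U => (((U e₀ : SUN N) : Matrix (Fin N) (Fin N) ℂ) * M).trace.re := by
      funext U; rfl
    rw [hcyl] at h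
    convert h using 2
    funext U
    congr 1
  have hsum := Finset.sum_le_sum fun a (_ : a ∈ (Finset.univ : Finset (Fin N))) =>
    Finset.sum_le_sum fun b (_ : b ∈ (Finset.univ : Finset (Fin N))) =>
      Finset.sum_le_sum fun c (_ : c ∈ ({(1 : ℂ), -Complex.I} : Finset ℂ)) => hone (Matrix.single b a c)
  simp only [← Finset.mul_sum] at hsum
  rw [hV, hG] at hsum
  exact le_of_mul_le_mul_right hsum hNpos

/-- ★★ **The window for the optimal gradient-form Poincaré constant of every limit point at strong coupling**, every `SU(N)` (`N ≥ 2`), `d`: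
for `|β| < 1/(8d)`, `K = N/2 − 4dN|β|` IS admissible for every limit point (G31 `szz_poincare_gradient_sharp_sun`, written as `K·Var ≤ Σ∫|∇F|²`) and
every admissible `K'` is `≤ N − 1/N` (§3).  The Yang–Mills mass gap is NOT proved. [cite: ShenZhuZhu2022, Theorem 1.4 (1.10)] -/
theorem limitPoincareConst_window_sun (hN : 2 ≤ N) {β : ℝ} (hK : 0 < (N : ℝ) / 2 - N * |β| * (4 * d)) {μ : Measure (LGConfig d (SUN N))}
    (hμ : μ ∈ infiniteVolumeLimitPoints (d := d) (fundamentalRep (Fin N)) ((N : ℝ) * β)) (e₀ : Literature.MathematicalPhysics.QuantumLattice.ZdEdge d) :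
    (∀ (Λ : Finset (Literature.MathematicalPhysics.QuantumLattice.ZdEdge d)) (f : (↥Λ → Matrix (Fin N) (Fin N) ℂ) → ℝ), ContDiff ℝ ∞ f →
      ((N : ℝ) / 2 - N * |β| * (4 * d)) * Var[matrixCylinder Λ f; μ] ≤
        ∑ e : ↥Λ, ∫ U, linkGradSq Λ f e (fun e' : ↥Λ => ((U e'.1 : SUN N) : Matrix (Fin N) (Fin N) ℂ)) ∂μ) ∧
    (∀ K' : ℝ, (∀ (Λ : Finset (Literature.MathematicalPhysics.QuantumLattice.ZdEdge d)) (f : (↥Λ → Matrix (Fin N) (Fin N) ℂ) → ℝ), ContDiff ℝ ∞ f →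
      K' * Var[matrixCylinder Λ f; μ] ≤ ∑ e : ↥Λ, ∫ U, linkGradSq Λ f e (fun e' : ↥Λ => ((U e'.1 : SUN N) : Matrix (Fin N) (Fin N) ℂ)) ∂μ) →
      K' ≤ (N : ℝ) - 1 / N) := by
  have hN0 : N ≠ 0 := by omega
  refine ⟨fun Λ f hf => ?_, fun K' hK' => limitPoincareConst_le_haarCeiling_sun hN hμ e₀ hK'⟩
  have h := szz_poincare_gradient_sharp_sun hN0 hK hμ Λ f hf
  rwa [le_div_iff₀ hK, mul_comm] at h

end Summit.QuantumFields.YangMills.Theorems.ColdStartUniversality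

end
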